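import Literature.NumberTheory.LFunctions.SekatskiiLiArithmeticFormulaProofs
import Literature.Analysis.SpecialFunctions.DigammaVerticalSeries
import Mathlib.Analysis.SpecialFunctions.Pow.Asymptotics
import HarnessLib

/-!
# Sekatskii's large-shift positivity theorem for the generalized Li derivatives — PROVED

LABEL (line 1): **RH-FREE** — for every `m` there is `c(m) > 0` such that ALL the generalized Li
derivatives `(1/(n−1)!) dⁿ/dzⁿ[(z+b)^{n−1} ln ξ(z)]|_{z=b+1}`, `1 ≤ n ≤ m`, are `≥ 0` for every
`b ≥ c(m)` (Sekatskii 2015, Theorem 5), PROVED here in the kernel from the tree's arithmetic formula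
for the generalized Li sums (Sekatskii 2014, Theorem 7) and Stirling's lower bound for `ψ`; with it
the RH-FREE limits `k_{n,a} → +∞` as `a → ±∞` (`n ≥ 1` fixed).  bears_on: LADDER-RH L-C/L-P (COLUMN 4,
LI; criterion catalogue, the `a`-family row).  WHAT THIS IS NOT (the author's own words, §4 p. 16:
"Certainly, what is proven in Theorem 5 is far from the proof of the Riemann hypothesis, where the
non-negativity in another limit, viz. that of some fixed `b > −1/2` (which can be arbitrary large)
and `n → ∞`, is required"): RH is `k_{n,a} ≥ 0` for ALL `n` at ONE `a ≠ ½` (`sekatskii2014_thm1`);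
positivity of finitely many `k_{n,a}` for `|a|` large is an explicit-formula bookkeeping fact
dominated by the digamma term and says nothing about zeros; nothing here bears on the truth of RH.

Source.  S. K. Sekatskii, *First applications of generalized Li's criterion to study the Riemann
zeta-function zeroes location*, arXiv:1404.7276v2 (2015) [Sekatskii2015FirstApplications], §3,
**Theorem 5** (p. 10 of the arXiv PDF): "For any arbitrary large integer `m` there exists positive
real `c` depending on `m` such that the inequality `(1/(n−1)!) dⁿ/dzⁿ((z+b)^{n−1} ln(ξ(z)))|_{z=b+1} ≥ 0`
does hold true for all `n ≤ m` and all `b ≥ c`."  (Published form: *On the generalized Li's criterion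
equivalent to the Riemann hypothesis and its first applications*, Springer Proc. Math. Stat. **358**
(2021) 241–254, doi:10.1007/978-3-030-68490-7_12 — not held, `acq-11710`; the displayed formulas of
the arXiv version were read off the PDF content streams, the held text extraction having lost them.)
Printed proof (pp. 13–14): every term of the author's decomposition (7) of the derivative (obtained
by his generalized Littlewood theorem) "is `O(1)` or smaller … apart from the positive `O(ln b)`
[digamma] term and the derivative [of `(z+b)^{n−1} ln ζ(z)`] which … is in
this limit exponentially small"; Remark 3 (p. 14): "The same Theorem 5 can be obtained starting from
the expression for the sums at question given in [1] as arithmetic interpretation of the generalized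
Li's sums" — i.e. from Theorem 7 / eq. (10) of [Sekatskii2014], which is the road taken here (the
tree has that formula PROVED: `Sekatskii2014_thm7_holds`).

## Dictionary (paper ↦ tree)

* paper's `b` = `−a` of [Sekatskii2014] and of the tree; the derivative
  `(1/(n−1)!) dⁿ/dzⁿ[(z+b)^{n−1} ln ξ(z)]|_{z=b+1}` is `liSekatskiiDeriv (−b) (b+1) n`
  (`SekatskiiGeneralizedLiCriterion.lean`), and by eq. (6) of [Sekatskii2014]
  (`Sekatskii2014_sum_eq_deriv_holds`) `k_{n,−b} = (1+2b)·liSekatskiiDeriv (−b) (b+1) n`, while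
  `k_{n,−b} = k_{n,1+b}` (`liSekatskiiSum_one_sub`) `= liSekatskiiArith (1+b) n` for `b > 0`
  (`Sekatskii2014_thm7_holds`).
* `liSekatskiiArith A n = [2 − (−1+1/A)ⁿ − (−1−1/(A−1))ⁿ] + [Σ_{j=1}^{n} C(n,j)(2A−1)^j((−1)^j/(j−1)!)
  Σ_m Λ(m)ln^{j−1}m/m^A] + [(n/2)(2A−1)(ψ(A/2) − ln π)] + [Σ_{j=2}^{n} C(n,j)(−1)^j2^{−j}(2A−1)^j ζ(j,A/2)]`
  =: closed + prime + digamma + Hurwitz parts.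

## Contents and proof architecture (Remark 3's road; sizes for `A → +∞`, `n` fixed)

* §1 `Sekatskii2015.closed_part_ge`: the closed part is `≥ −(1 + 2ⁿ)` for `A ≥ 2`.
* §2 `Sekatskii2015.vm_term_le`, `vm_series_le`, `abs_prime_part_le`: for `A ≥ n+2` the prime part
  is `≤ n·2^{3n+2}·S₂ · Aⁿ2^{−A}` in absolute value (`S₂ = Σ 1/m²`; "exponentially small", p. 14),
  from `Λ(m) ≤ ln m ≤ m` and `m^{−A} ≤ 2^{j+2−A} m^{−2−j}·m^{j}`-bookkeeping.
* §3 `Sekatskii2015.digamma_part_ge`: the digamma part is `≥ (n/2)(2A−1)(ln A − 4)` for `A ≥ 2`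
  (Stirling's lower bound `ln x − 1/(2x) − 1/(12x²) ≤ ψ(x)`, the tree's
  `Literature.Analysis.SpecialFunctions.Real.log_sub_le_re_digamma`; "the positive `O(ln b)` term").
* §4 `Sekatskii2015.sum_inv_add_sq_le` (telescoping `Σ_{m<N} (m+x)^{−2} ≤ x^{−2} + x^{−1}`),
  `hurwitz_series_le` (`ζ(j, x) ≤ 2x^{1−j}`, `x ≥ 1`, `j ≥ 2`), `abs_hurwitz_part_le`: the Hurwitz
  part is `≤ n·4ⁿ·A` in absolute value for `A ≥ 2` ("`O(1)` or smaller" after division by `2b+1`).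
* §5 `Sekatskii2015.tendsto_liSekatskiiArith_atTop`: hence `liSekatskiiArith A n → +∞` (`n ≥ 1`), and
  — RH-FREE theorems about Sekatskii's sums over the zeros — `tendsto_liSekatskiiSum_atTop`
  (`k_{n,a} → +∞` as `a → +∞`, via Theorem 7) and `tendsto_liSekatskiiSum_atBot` (as `a → −∞`, via
  `k_{n,1−a} = k_{n,a}`).
* **Theorem 5** `sekatskii2015_thm5` (as printed, for the derivatives at `z = b+1`) and its sum form
  `sekatskii2015_thm5_sum` (`∃ c, |a − ½| ≥ c ⟹ k_{n,a} ≥ 0 ∀ n ≤ m`) — PROVED.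

Deliberately NOT here: Lemma 1 / eq. (9)–(10) (the Laguerre-polynomial form of
`dⁿ[(z+b)^{n−1} ln ζ(z)]` for `Re z > 1`; its displayed normalisation is not recoverable with
certainty from the extraction — the `b = 0` case is the Coffey/Laguerre bookkeeping already in the
tree's Li column files), Lemma 2 (eq. (11), large-`n` asymptotic of the trivial-zero sum at fixed `b`)
and Lemma 3 (eq. (12), an integral bound) — proof tools of the author's road (7), not needed on
Remark 3's road; Proposition 1 ("not very interesting" sufficient criterion, author's words); eq. (21)
and the sentence "We suspect, but cannot prove, that an exact compensation indeed occurs" (a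
conjecture — not Literature); Remark 4 (Dedekind zeta sketch).  Theorem 6 / (A1) (the RH-conditional
asymptotic) is the sibling file `SekatskiiLiSumsAsymptotic.lean`.  No named facts are introduced.

## References

* [Sekatskii2015FirstApplications] S. K. Sekatskii, arXiv:1404.7276v2 (2015), §3 Theorem 5 (p. 10),
  proof pp. 13–14, Remark 3 (p. 14), §4 (p. 16); Springer PROMS 358 (2021) 241–254.
* [Sekatskii2014] S. K. Sekatskii, Ukr. Math. J. 66 (2014) 415–431, Thm 7 eq. (10), eq. (6), Thm 1.
* Stirling-type bound `ln x − 1/(2x) − 1/(12x²) ≤ ψ(x)` (folklore; H. Alzer, Math. Comp. 66 (1997)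
  373–389, (2.2)) — tree: `Literature/Analysis/SpecialFunctions/DigammaVerticalSeries.lean`.
-/

noncomputable section

open Filter Topology Real Finset
open scoped Nat ArithmeticFunction.vonMangoldt

namespace Literature.NumberTheory.LFunctions

namespace Sekatskii2015

/-! ### §1. The closed part `2 − (−1+1/A)ⁿ − (−1−1/(A−1))ⁿ` is bounded -/

/-- For `A ≥ 2`: `2 − (−1+1/A)ⁿ − (−1−1/(A−1))ⁿ ≥ −(1 + 2ⁿ)` (`|−1+1/A| ≤ 1`, `|−1−1/(A−1)| ≤ 2`).
[cite: Sekatskii2015FirstApplications, Theorem 5 (proof, p. 13: "all terms … are O(1) or smaller")] -/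
theorem closed_part_ge {A : ℝ} (hA : 2 ≤ A) (n : ℕ) :
    -(1 + 2 ^ n : ℝ) ≤ 2 - (-1 + 1 / A) ^ n - (-1 - 1 / (A - 1)) ^ n := by
  have hA0 : 0 < A := by linarith
  have h1 : |(-1 + 1 / A) ^ n| ≤ 1 := by
    rw [abs_pow]
    refine pow_le_one₀ (abs_nonneg _) (abs_le.2 ⟨?_, ?_⟩)
    · have : 0 ≤ 1 / A := by positivity
      linarith
    · have : 1 / A ≤ 1 := by rw [div_le_one hA0]; linarith
      linarith
  have h2 : |(-1 - 1 / (A - 1)) ^ n| ≤ 2 ^ n := by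
    rw [abs_pow]
    refine pow_le_pow_left₀ (abs_nonneg _) (abs_le.2 ⟨?_, ?_⟩) n
    · have : 1 / (A - 1) ≤ 1 := by rw [div_le_one (by linarith)]; linarith
      linarith
    · have : 0 ≤ 1 / (A - 1) := one_div_nonneg.2 (by linarith)
      linarith
  linarith [le_abs_self ((-1 + 1 / A) ^ n), le_abs_self ((-1 - 1 / (A - 1)) ^ n)]

/-! ### §2. The prime part is exponentially small -/

/-- Termwise: for `j ≥ 1`, `A ≥ j + 2` and every `m`,
`Λ(m) ln^{j−1} m / m^A ≤ 2^{j+2−A}·(1/m²)` (`Λ(m) ≤ ln m ≤ m`, `m^A = m^{j+2}·m^{A−j−2} ≥ m^{j+2}2^{A−j−2}`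
for `m ≥ 2`; the terms `m = 0, 1` vanish).
[cite: Sekatskii2015FirstApplications, Theorem 5 (proof, p. 14: "exponentially small and can be neglected")] -/
theorem vm_term_le {A : ℝ} {j : ℕ} (hj : 1 ≤ j) (hA : (j : ℝ) + 2 ≤ A) (m : ℕ) :
    (Λ m : ℝ) * Real.log m ^ (j - 1) / (m : ℝ) ^ A ≤
      (2 : ℝ) ^ ((j : ℝ) + 2 - A) * (1 / (m : ℝ) ^ 2) := by
  rcases lt_or_ge m 2 with hm | hm
  · have hΛ : (Λ m : ℝ) = 0 := by
      interval_cases m <;> simp [ArithmeticFunction.vonMangoldt_apply_one]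
    rw [hΛ, zero_mul, zero_div]
    positivity
  · have hm' : (2 : ℝ) ≤ m := by exact_mod_cast hm
    have hm0 : (0 : ℝ) < m := by linarith
    have hlog0 : 0 ≤ Real.log m := Real.log_nonneg (by linarith)
    have hlogle : Real.log m ≤ m := (Real.log_le_sub_one_of_pos hm0).trans (by linarith)
    have hnum : (Λ m : ℝ) * Real.log m ^ (j - 1) ≤ (m : ℝ) ^ j := by
      calc (Λ m : ℝ) * Real.log m ^ (j - 1) ≤ Real.log m * Real.log m ^ (j - 1) :=
            mul_le_mul_of_nonneg_right ArithmeticFunction.vonMangoldt_le_log (pow_nonneg hlog0 _)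
        _ = Real.log m ^ j := by rw [← pow_succ', Nat.sub_add_cancel hj]
        _ ≤ (m : ℝ) ^ j := pow_le_pow_left₀ hlog0 hlogle j
    set t : ℝ := A - ((j : ℝ) + 2) with ht
    have ht0 : 0 ≤ t := by linarith
    have hsplit : (m : ℝ) ^ A = (m : ℝ) ^ (j + 2) * (m : ℝ) ^ t := by
      rw [show A = ((j + 2 : ℕ) : ℝ) + t by push_cast; linarith, Real.rpow_add hm0,
        Real.rpow_natCast]
    have hmt : (2 : ℝ) ^ t ≤ (m : ℝ) ^ t := Real.rpow_le_rpow (by norm_num) hm' ht0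
    have h2t : 0 < (2 : ℝ) ^ t := by positivity
    have h2neg : (2 : ℝ) ^ ((j : ℝ) + 2 - A) = 1 / (2 : ℝ) ^ t := by
      rw [ht, show (j : ℝ) + 2 - A = -(A - ((j : ℝ) + 2)) by ring, Real.rpow_neg (by norm_num),
        one_div]
    rw [h2neg, hsplit, div_le_iff₀ (by positivity)]
    calc (Λ m : ℝ) * Real.log m ^ (j - 1) ≤ (m : ℝ) ^ j := hnum
      _ = 1 / (2 : ℝ) ^ t * (1 / (m : ℝ) ^ 2) * ((m : ℝ) ^ (j + 2) * (2 : ℝ) ^ t) := by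
          field_simp
          ring
      _ ≤ 1 / (2 : ℝ) ^ t * (1 / (m : ℝ) ^ 2) * ((m : ℝ) ^ (j + 2) * (m : ℝ) ^ t) := by
          gcongr

/-- `Σ_m 1/m²` converges (the majorant; Lean's `m = 0` term is `0`). [folklore] -/
private theorem summable_inv_sq : Summable fun m : ℕ ↦ 1 / (m : ℝ) ^ 2 :=
  Real.summable_one_div_nat_pow.2 (by norm_num)

/-- The series bound: for `j ≥ 1`, `A ≥ j + 2`, `Σ_m Λ(m) ln^{j−1} m/m^A ≤ 2^{j+2−A}·Σ_m 1/m²`.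
[cite: Sekatskii2015FirstApplications, Theorem 5 (proof, p. 14)] -/
theorem vm_series_le {A : ℝ} {j : ℕ} (hj : 1 ≤ j) (hA : (j : ℝ) + 2 ≤ A) :
    ∑' m : ℕ, (Λ m : ℝ) * Real.log m ^ (j - 1) / (m : ℝ) ^ A ≤
      (2 : ℝ) ^ ((j : ℝ) + 2 - A) * ∑' m : ℕ, 1 / (m : ℝ) ^ 2 := by
  have hnn : ∀ m : ℕ, 0 ≤ (Λ m : ℝ) * Real.log m ^ (j - 1) / (m : ℝ) ^ A := fun m ↦
    div_nonneg (mul_nonneg ArithmeticFunction.vonMangoldt_nonneg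
      (pow_nonneg (Real.log_natCast_nonneg m) _)) (Real.rpow_nonneg (Nat.cast_nonneg m) A)
  refine Real.tsum_le_of_sum_range_le hnn fun N ↦ ?_
  calc ∑ m ∈ Finset.range N, (Λ m : ℝ) * Real.log m ^ (j - 1) / (m : ℝ) ^ A
      ≤ ∑ m ∈ Finset.range N, (2 : ℝ) ^ ((j : ℝ) + 2 - A) * (1 / (m : ℝ) ^ 2) :=
        Finset.sum_le_sum fun m _ ↦ vm_term_le hj hA m
    _ = (2 : ℝ) ^ ((j : ℝ) + 2 - A) * ∑ m ∈ Finset.range N, 1 / (m : ℝ) ^ 2 := by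
        rw [Finset.mul_sum]
    _ ≤ (2 : ℝ) ^ ((j : ℝ) + 2 - A) * ∑' m : ℕ, 1 / (m : ℝ) ^ 2 := by
        gcongr
        exact summable_inv_sq.sum_le_tsum (Finset.range N) (fun m _ ↦ by positivity)

/-- **The prime part is exponentially small**: for `A ≥ n + 2`,
`|Σ_{j=1}^{n} C(n,j)(2A−1)^j((−1)^j/(j−1)!) Σ_m Λ(m)ln^{j−1}m/m^A| ≤ n·2^{3n+2}·(Σ 1/m²)·Aⁿ·2^{−A}`.
[cite: Sekatskii2015FirstApplications, Theorem 5 (proof, p. 14: "exponentially small")] -/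
theorem abs_prime_part_le {A : ℝ} {n : ℕ} (hA : (n : ℝ) + 2 ≤ A) :
    |∑ j ∈ Icc 1 n, (n.choose j : ℝ) * (2 * A - 1) ^ j * ((-1) ^ j / ((j - 1)! : ℝ)) *
        ∑' m : ℕ, (Λ m : ℝ) * Real.log m ^ (j - 1) / (m : ℝ) ^ A|
      ≤ n * (2 ^ (3 * n + 2) * (∑' m : ℕ, 1 / (m : ℝ) ^ 2) * (A ^ n * (2 : ℝ) ^ (-A))) := by
  set S₂ : ℝ := ∑' m : ℕ, 1 / (m : ℝ) ^ 2 with hS₂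
  have hS₂0 : 0 ≤ S₂ := tsum_nonneg fun m ↦ by positivity
  have hA2 : 2 ≤ A := by have := (Nat.cast_nonneg n : (0 : ℝ) ≤ n); linarith
  have hA0 : 0 < A := by linarith
  have h2A : 0 ≤ 2 * A - 1 := by linarith
  refine (Finset.abs_sum_le_sum_abs _ _).trans ?_
  have hterm : ∀ j ∈ Icc 1 n,
      |(n.choose j : ℝ) * (2 * A - 1) ^ j * ((-1) ^ j / ((j - 1)! : ℝ)) *
          ∑' m : ℕ, (Λ m : ℝ) * Real.log m ^ (j - 1) / (m : ℝ) ^ A|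
        ≤ 2 ^ (3 * n + 2) * S₂ * (A ^ n * (2 : ℝ) ^ (-A)) := by
    intro j hj
    rw [Finset.mem_Icc] at hj
    obtain ⟨hj1, hjn⟩ := hj
    have hjA : (j : ℝ) + 2 ≤ A := by
      have : (j : ℝ) ≤ n := by exact_mod_cast hjn
      linarith
    have hP0 : 0 ≤ ∑' m : ℕ, (Λ m : ℝ) * Real.log m ^ (j - 1) / (m : ℝ) ^ A :=
      tsum_nonneg fun m ↦ div_nonneg (mul_nonneg ArithmeticFunction.vonMangoldt_nonneg
        (pow_nonneg (Real.log_natCast_nonneg m) _)) (Real.rpow_nonneg (Nat.cast_nonneg m) A)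
    have hP := vm_series_le hj1 hjA
    -- sizes of the factors
    have hchoose : (n.choose j : ℝ) ≤ 2 ^ n := by exact_mod_cast Nat.choose_le_two_pow n j
    have hpow : (2 * A - 1) ^ j ≤ (2 * A) ^ n :=
      (pow_le_pow_left₀ h2A (by linarith) j).trans (pow_le_pow_right₀ (by linarith) hjn)
    have hfact : 1 / ((j - 1)! : ℝ) ≤ 1 := by
      rw [div_le_one (by positivity)]
      exact_mod_cast Nat.one_le_iff_ne_zero.2 (Nat.factorial_ne_zero _)
    have hexp : (2 : ℝ) ^ ((j : ℝ) + 2 - A) ≤ 2 ^ (n + 2) * (2 : ℝ) ^ (-A) := by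
      calc (2 : ℝ) ^ ((j : ℝ) + 2 - A) ≤ (2 : ℝ) ^ ((n : ℝ) + 2 - A) :=
            Real.rpow_le_rpow_of_exponent_le (by norm_num) (by
              have : (j : ℝ) ≤ n := by exact_mod_cast hjn
              linarith)
        _ = 2 ^ (n + 2) * (2 : ℝ) ^ (-A) := by
            rw [show (n : ℝ) + 2 - A = ((n + 2 : ℕ) : ℝ) + (-A) by push_cast; ring,
              Real.rpow_add (by norm_num), Real.rpow_natCast]
    have habs : |(n.choose j : ℝ) * (2 * A - 1) ^ j * ((-1) ^ j / ((j - 1)! : ℝ)) *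
        ∑' m : ℕ, (Λ m : ℝ) * Real.log m ^ (j - 1) / (m : ℝ) ^ A| =
        (n.choose j : ℝ) * (2 * A - 1) ^ j * (1 / ((j - 1)! : ℝ)) *
          ∑' m : ℕ, (Λ m : ℝ) * Real.log m ^ (j - 1) / (m : ℝ) ^ A := by
      rw [abs_mul, abs_mul, abs_mul, abs_of_nonneg hP0, abs_div, abs_pow, abs_pow, abs_neg,
        abs_one, one_pow, abs_of_nonneg h2A, Nat.abs_cast, Nat.abs_cast]
    rw [habs]
    have h2An : 0 ≤ (2 * A) ^ n := by positivity
    calc (n.choose j : ℝ) * (2 * A - 1) ^ j * (1 / ((j - 1)! : ℝ)) *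
          ∑' m : ℕ, (Λ m : ℝ) * Real.log m ^ (j - 1) / (m : ℝ) ^ A
        ≤ 2 ^ n * (2 * A) ^ n * 1 * ((2 ^ (n + 2) * (2 : ℝ) ^ (-A)) * S₂) := by
          gcongr
          exact hP.trans (mul_le_mul_of_nonneg_right hexp hS₂0)
      _ = 2 ^ (3 * n + 2) * S₂ * (A ^ n * (2 : ℝ) ^ (-A)) := by
          rw [mul_pow]; ring
  calc ∑ j ∈ Icc 1 n, |(n.choose j : ℝ) * (2 * A - 1) ^ j * ((-1) ^ j / ((j - 1)! : ℝ)) *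
          ∑' m : ℕ, (Λ m : ℝ) * Real.log m ^ (j - 1) / (m : ℝ) ^ A|
      ≤ ∑ j ∈ Icc 1 n, 2 ^ (3 * n + 2) * S₂ * (A ^ n * (2 : ℝ) ^ (-A)) := Finset.sum_le_sum hterm
    _ = n * (2 ^ (3 * n + 2) * S₂ * (A ^ n * (2 : ℝ) ^ (-A))) := by
        rw [Finset.sum_const, Nat.card_Icc, nsmul_eq_mul]
        simp

/-! ### §3. The digamma part dominates -/

open Literature.Analysis.SpecialFunctions in
/-- **The digamma part is `≥ (n/2)(2A−1)(ln A − 4)`** for `A ≥ 2`: Stirling's lower bound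
`ψ(A/2) ≥ ln(A/2) − 1/A − 1/(3A²)` and `ln 2 + 7/12 + ln π ≤ 4` ("the positive `O(ln b)` term",
p. 13). [cite: Sekatskii2015FirstApplications, Theorem 5 (proof, p. 13–14)] -/
theorem digamma_part_ge {A : ℝ} (hA : 2 ≤ A) (n : ℕ) :
    (n : ℝ) / 2 * (2 * A - 1) * (Real.log A - 4) ≤
      (n : ℝ) / 2 * (2 * A - 1) * ((Complex.digamma ((A / 2 : ℝ) : ℂ)).re - Real.log Real.pi) := by
  have hx : 0 < A / 2 := by linarith
  have hψ := Real.log_sub_le_re_digamma hx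
  have hlog2 : Real.log 2 < 1 := by
    have := Real.log_two_lt_d9; norm_num at this; linarith
  have hlogpi : Real.log Real.pi ≤ 2 := by
    have h4 : Real.log Real.pi ≤ Real.log 4 :=
      Real.log_le_log Real.pi_pos (le_of_lt Real.pi_lt_four)
    have : Real.log 4 = 2 * Real.log 2 := by
      rw [show (4 : ℝ) = 2 ^ 2 by norm_num, Real.log_pow]; norm_num
    linarith
  have hloga : Real.log (A / 2) = Real.log A - Real.log 2 := Real.log_div (by linarith) (by norm_num)
  have h1 : 1 / (2 * (A / 2)) ≤ 1 / 2 := by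
    rw [show 2 * (A / 2) = A by ring]
    exact one_div_le_one_div_of_le (by norm_num) hA
  have h2 : 1 / (12 * (A / 2) ^ 2) ≤ 1 / 12 := by
    apply one_div_le_one_div_of_le (by norm_num)
    nlinarith
  have hcoef : 0 ≤ (n : ℝ) / 2 * (2 * A - 1) := mul_nonneg (by positivity) (by linarith)
  have key : Real.log A - 4 ≤ (Complex.digamma ((A / 2 : ℝ) : ℂ)).re - Real.log Real.pi := by
    rw [hloga] at hψ; linarith
  exact mul_le_mul_of_nonneg_left key hcoef

/-! ### §4. The Hurwitz part is at most linear in `A` -/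

/-- Telescoping: for `x > 0` and every `N`, `Σ_{m<N} 1/(m+x)² ≤ 1/x² + 1/x`
(`1/(m+x)² ≤ 1/(m−1+x) − 1/(m+x)` for `m ≥ 1`). [folklore] -/
private theorem sum_inv_add_sq_le {x : ℝ} (hx : 0 < x) (N : ℕ) :
    ∑ m ∈ Finset.range N, 1 / ((m : ℝ) + x) ^ 2 ≤ 1 / x ^ 2 + 1 / x := by
  have aux : ∀ N : ℕ, ∑ m ∈ Finset.range (N + 1), 1 / ((m : ℝ) + x) ^ 2 ≤
      1 / x ^ 2 + 1 / x - 1 / ((N : ℝ) + x) := by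
    intro N
    induction N with
    | zero => simp
    | succ N ih =>
      rw [Finset.sum_range_succ]
      have hu : 0 < (N : ℝ) + x := by positivity
      have hstep : 1 / (((N + 1 : ℕ) : ℝ) + x) ^ 2 ≤
          1 / ((N : ℝ) + x) - 1 / (((N + 1 : ℕ) : ℝ) + x) := by
        push_cast
        rw [div_sub_div _ _ hu.ne' (by positivity), div_le_div_iff₀ (by positivity) (by positivity)]
        nlinarith
      linarith
  rcases N with _ | N
  · simp only [Finset.range_zero, Finset.sum_empty]
    positivity
  · have h := aux N
    have : 0 < 1 / ((N : ℝ) + x) := by positivity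
    linarith

/-- `ζ(j, x) = Σ_{m≥0} (m+x)^{−j} ≤ 2/x^{j−1}` for `x ≥ 1`, `j ≥ 2` (`(m+x)^j ≥ (m+x)²x^{j−2}` and the
telescoping bound). [folklore] -/
private theorem hurwitz_series_le {x : ℝ} (hx : 1 ≤ x) {j : ℕ} (hj : 2 ≤ j) :
    ∑' m : ℕ, 1 / ((m : ℝ) + x) ^ j ≤ 2 / x ^ (j - 1) := by
  have hx0 : 0 < x := by linarith
  obtain ⟨i, rfl⟩ : ∃ i, j = i + 2 := ⟨j - 2, by omega⟩
  have hterm : ∀ m : ℕ, 1 / ((m : ℝ) + x) ^ (i + 2) ≤ 1 / x ^ i * (1 / ((m : ℝ) + x) ^ 2) := by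
    intro m
    have hmx : x ≤ (m : ℝ) + x := by
      have := (Nat.cast_nonneg m : (0 : ℝ) ≤ m); linarith
    rw [pow_add, one_div_mul_one_div]
    apply one_div_le_one_div_of_le (by positivity)
    gcongr
  refine Real.tsum_le_of_sum_range_le (fun m ↦ by positivity) fun N ↦ ?_
  calc ∑ m ∈ Finset.range N, 1 / ((m : ℝ) + x) ^ (i + 2)
      ≤ ∑ m ∈ Finset.range N, 1 / x ^ i * (1 / ((m : ℝ) + x) ^ 2) :=
        Finset.sum_le_sum fun m _ ↦ hterm m
    _ = 1 / x ^ i * ∑ m ∈ Finset.range N, 1 / ((m : ℝ) + x) ^ 2 := by rw [Finset.mul_sum]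
    _ ≤ 1 / x ^ i * (1 / x ^ 2 + 1 / x) := by
        gcongr
        exact sum_inv_add_sq_le hx0 N
    _ ≤ 1 / x ^ i * (2 / x) := by
        gcongr 1 / x ^ i * ?_
        have h2 : 1 / x ^ 2 ≤ 1 / x := by
          apply one_div_le_one_div_of_le hx0
          nlinarith
        calc 1 / x ^ 2 + 1 / x ≤ 1 / x + 1 / x := by gcongr
          _ = 2 / x := by ring
    _ = 2 / x ^ (i + 2 - 1) := by
        rw [show i + 2 - 1 = i + 1 by omega, pow_succ]
        field_simp

/-- **The Hurwitz part is at most linear**: for `A ≥ 2`,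
`|Σ_{j=2}^{n} C(n,j)(−1)^j (2A−1)^j/2^j · ζ(j, A/2)| ≤ n·4ⁿ·A` (`ζ(j, A/2) ≤ 2(2/A)^{j−1}`).
[cite: Sekatskii2015FirstApplications, Theorem 5 (proof, p. 13: "O(1) or smaller")] -/
theorem abs_hurwitz_part_le {A : ℝ} (hA : 2 ≤ A) (n : ℕ) :
    |∑ j ∈ Icc 2 n, (n.choose j : ℝ) * (-1) ^ j * (2 * A - 1) ^ j / 2 ^ j *
        ∑' m : ℕ, 1 / ((m : ℝ) + A / 2) ^ j| ≤ n * 4 ^ n * A := by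
  have hA0 : 0 < A := by linarith
  have hx : 1 ≤ A / 2 := by linarith
  have h2A : 0 ≤ 2 * A - 1 := by linarith
  refine (Finset.abs_sum_le_sum_abs _ _).trans ?_
  have hterm : ∀ j ∈ Icc 2 n,
      |(n.choose j : ℝ) * (-1) ^ j * (2 * A - 1) ^ j / 2 ^ j * ∑' m : ℕ, 1 / ((m : ℝ) + A / 2) ^ j|
        ≤ 4 ^ n * A := by
    intro j hj
    rw [Finset.mem_Icc] at hj
    obtain ⟨hj2, hjn⟩ := hj
    have hH0 : 0 ≤ ∑' m : ℕ, 1 / ((m : ℝ) + A / 2) ^ j := tsum_nonneg fun m ↦ by positivity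
    have hH := hurwitz_series_le hx hj2
    have habs : |(n.choose j : ℝ) * (-1) ^ j * (2 * A - 1) ^ j / 2 ^ j *
        ∑' m : ℕ, 1 / ((m : ℝ) + A / 2) ^ j| =
        (n.choose j : ℝ) * (2 * A - 1) ^ j / 2 ^ j * ∑' m : ℕ, 1 / ((m : ℝ) + A / 2) ^ j := by
      rw [abs_mul, abs_of_nonneg hH0, abs_div, abs_mul, abs_mul, abs_pow, abs_pow, abs_neg,
        abs_one, one_pow, mul_one, abs_of_nonneg h2A, abs_pow, abs_two,
        abs_of_nonneg (by positivity : (0 : ℝ) ≤ (n.choose j : ℝ))]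
    rw [habs]
    have hchoose : (n.choose j : ℝ) ≤ 2 ^ n := by exact_mod_cast Nat.choose_le_two_pow n j
    -- `(2A−1)^j/2^j ≤ A^j`
    have hratio : (2 * A - 1) ^ j / 2 ^ j ≤ A ^ j := by
      rw [div_le_iff₀ (by positivity), ← mul_pow]
      exact pow_le_pow_left₀ h2A (by linarith) j
    -- `ζ(j, A/2) ≤ 2/(A/2)^{j-1} = 2^j / A^{j-1}`
    have hH' : ∑' m : ℕ, 1 / ((m : ℝ) + A / 2) ^ j ≤ 2 ^ j / A ^ (j - 1) := by
      refine hH.trans (le_of_eq ?_)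
      obtain ⟨i, rfl⟩ : ∃ i, j = i + 1 := ⟨j - 1, by omega⟩
      rw [show i + 1 - 1 = i by omega, div_pow, pow_succ]
      field_simp
    have h2j : (2 : ℝ) ^ j ≤ 2 ^ n := pow_le_pow_right₀ (by norm_num) hjn
    calc (n.choose j : ℝ) * (2 * A - 1) ^ j / 2 ^ j * ∑' m : ℕ, 1 / ((m : ℝ) + A / 2) ^ j
        = (n.choose j : ℝ) * ((2 * A - 1) ^ j / 2 ^ j) * ∑' m : ℕ, 1 / ((m : ℝ) + A / 2) ^ j := by
          ring
      _ ≤ 2 ^ n * A ^ j * (2 ^ j / A ^ (j - 1)) := by gcongr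
      _ = 2 ^ n * 2 ^ j * A := by
          obtain ⟨i, rfl⟩ : ∃ i, j = i + 1 := ⟨j - 1, by omega⟩
          rw [show i + 1 - 1 = i by omega, pow_succ]
          field_simp
      _ ≤ 2 ^ n * 2 ^ n * A := by gcongr
      _ = 4 ^ n * A := by rw [← mul_pow]; norm_num
  calc ∑ j ∈ Icc 2 n, |(n.choose j : ℝ) * (-1) ^ j * (2 * A - 1) ^ j / 2 ^ j *
          ∑' m : ℕ, 1 / ((m : ℝ) + A / 2) ^ j|
      ≤ ∑ j ∈ Icc 2 n, 4 ^ n * A := Finset.sum_le_sum hterm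
    _ = ((n + 1 - 2 : ℕ) : ℝ) * (4 ^ n * A) := by
        rw [Finset.sum_const, Nat.card_Icc, nsmul_eq_mul]
    _ ≤ n * (4 ^ n * A) := by
        gcongr
        exact_mod_cast (by omega : n + 1 - 2 ≤ n)
    _ = n * 4 ^ n * A := by ring

/-! ### §5. `liSekatskiiArith A n → +∞` and the limits of the sums -/

/-- The decomposition of `liSekatskiiArith` into its four parts (definitional).
[cite: Sekatskii2014, Thm 7, eq. (10)] -/
theorem liSekatskiiArith_eq (A : ℝ) (n : ℕ) :
    liSekatskiiArith A n =
      (2 - (-1 + 1 / A) ^ n - (-1 - 1 / (A - 1)) ^ n)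
      + (∑ j ∈ Icc 1 n, (n.choose j : ℝ) * (2 * A - 1) ^ j * ((-1) ^ j / ((j - 1)! : ℝ)) *
          ∑' m : ℕ, (Λ m : ℝ) * Real.log m ^ (j - 1) / (m : ℝ) ^ A)
      + (n : ℝ) / 2 * (2 * A - 1) * ((Complex.digamma ((A / 2 : ℝ) : ℂ)).re - Real.log Real.pi)
      + ∑ j ∈ Icc 2 n, (n.choose j : ℝ) * (-1) ^ j * (2 * A - 1) ^ j / 2 ^ j *
          ∑' m : ℕ, 1 / ((m : ℝ) + A / 2) ^ j := rfl

/-- `Aⁿ·2^{−A} → 0` ("exponentially small"). [folklore] -/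
private theorem tendsto_pow_mul_two_rpow_neg (n : ℕ) :
    Tendsto (fun A : ℝ ↦ A ^ n * (2 : ℝ) ^ (-A)) atTop (𝓝 0) := by
  have h := tendsto_rpow_mul_exp_neg_mul_atTop_nhds_zero (n : ℝ) (Real.log 2) (Real.log_pos one_lt_two)
  refine h.congr' ?_
  filter_upwards [eventually_ge_atTop 0] with A hA
  rw [Real.rpow_natCast, Real.rpow_def_of_pos two_pos]
  ring_nf

/-- **A lower bound tending to infinity**: for `n ≥ 1`, eventually (in `A`)
`liSekatskiiArith A n ≥ A·((n/2)(ln A − 4) − K)` with `K = 1 + 2ⁿ + n·2^{3n+2}·Σ1/m² + n·4ⁿ`.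
[cite: Sekatskii2015FirstApplications, Theorem 5 (proof, pp. 13–14)] -/
theorem eventually_liSekatskiiArith_ge (n : ℕ) :
    ∀ᶠ A : ℝ in atTop,
      A * ((n : ℝ) / 2 * (Real.log A - 4) -
        (1 + 2 ^ n + n * (2 ^ (3 * n + 2) * ∑' m : ℕ, 1 / (m : ℝ) ^ 2) + n * 4 ^ n))
        ≤ liSekatskiiArith A n := by
  set S₂ : ℝ := ∑' m : ℕ, 1 / (m : ℝ) ^ 2 with hS₂
  have hS₂0 : 0 ≤ S₂ := tsum_nonneg fun m ↦ by positivity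
  have hE := (tendsto_order.1 (tendsto_pow_mul_two_rpow_neg n)).2 1 zero_lt_one
  filter_upwards [eventually_ge_atTop ((n : ℝ) + 2), eventually_ge_atTop (Real.exp 4), hE]
    with A hAn hAe hEA
  have hA2 : 2 ≤ A := by have := (Nat.cast_nonneg n : (0 : ℝ) ≤ n); linarith
  have hA1 : 1 ≤ A := by linarith
  have hlogA : 4 ≤ Real.log A := by
    rw [← Real.log_exp 4]; exact Real.log_le_log (Real.exp_pos 4) hAe
  have h1 := closed_part_ge hA2 n
  have h2 := abs_prime_part_le hAn
  have h3 := digamma_part_ge hA2 n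
  have h4 := abs_hurwitz_part_le hA2 n
  rw [abs_le] at h2 h4
  rw [liSekatskiiArith_eq]
  -- `(2A−1)(ln A − 4) ≥ A(ln A − 4)` and the exponentially small term is `≤ its constant`
  have h5 : A * (Real.log A - 4) ≤ (2 * A - 1) * (Real.log A - 4) := by nlinarith
  have h6 : (n : ℝ) / 2 * (A * (Real.log A - 4)) ≤ (n : ℝ) / 2 * (2 * A - 1) * (Real.log A - 4) := by
    have := mul_le_mul_of_nonneg_left h5 (by positivity : (0 : ℝ) ≤ n / 2)
    linarith
  have h7 : (n : ℝ) * (2 ^ (3 * n + 2) * S₂ * (A ^ n * (2 : ℝ) ^ (-A))) ≤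
      n * (2 ^ (3 * n + 2) * S₂) := by
    have : 2 ^ (3 * n + 2) * S₂ * (A ^ n * (2 : ℝ) ^ (-A)) ≤ 2 ^ (3 * n + 2) * S₂ * 1 :=
      mul_le_mul_of_nonneg_left hEA.le (by positivity)
    have := mul_le_mul_of_nonneg_left this (Nat.cast_nonneg n)
    linarith
  have h8 : (1 + 2 ^ n + n * (2 ^ (3 * n + 2) * S₂) : ℝ) ≤
      A * (1 + 2 ^ n + n * (2 ^ (3 * n + 2) * S₂)) := by
    have : (0 : ℝ) ≤ 1 + 2 ^ n + n * (2 ^ (3 * n + 2) * S₂) := by positivity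
    nlinarith
  nlinarith

/-- **`liSekatskiiArith A n → +∞` as `A → +∞`** for every `n ≥ 1` (Remark 3's road to Theorem 5:
"the expression … is dominated by the positive term"). [cite: Sekatskii2015FirstApplications, Theorem 5 and Remark 3 (p. 14)] -/
theorem tendsto_liSekatskiiArith_atTop {n : ℕ} (hn : 1 ≤ n) :
    Tendsto (fun A : ℝ ↦ liSekatskiiArith A n) atTop atTop := by
  set K : ℝ := 1 + 2 ^ n + n * (2 ^ (3 * n + 2) * ∑' m : ℕ, 1 / (m : ℝ) ^ 2) + n * 4 ^ n with hK
  have hn' : (0 : ℝ) < n / 2 := by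
    have : (1 : ℝ) ≤ n := by exact_mod_cast hn
    linarith
  have hg : Tendsto (fun A : ℝ ↦ (n : ℝ) / 2 * (Real.log A - 4) - K) atTop atTop := by
    have h := tendsto_atTop_add_const_right atTop (-(2 * n + K))
      (Real.tendsto_log_atTop.const_mul_atTop hn')
    refine h.congr fun A ↦ ?_
    ring
  have hprod : Tendsto (fun A : ℝ ↦ A * ((n : ℝ) / 2 * (Real.log A - 4) - K)) atTop atTop :=
    tendsto_id.atTop_mul_atTop₀ hg
  exact tendsto_atTop_mono' atTop (eventually_liSekatskiiArith_ge n) hprod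

/-- **`k_{n,a} → +∞` as `a → +∞`** (`n ≥ 1` fixed) — RH-FREE: for `a > 1`, `k_{n,a} = liSekatskiiArith a n`
(Theorem 7 of [Sekatskii2014], `Sekatskii2014_thm7_holds`). [cite: Sekatskii2015FirstApplications, Theorem 5 and Remark 3 (p. 14)] -/
theorem tendsto_liSekatskiiSum_atTop {n : ℕ} (hn : 1 ≤ n) :
    Tendsto (fun a : ℝ ↦ liSekatskiiSum a n) atTop atTop := by
  refine (tendsto_liSekatskiiArith_atTop hn).congr' ?_
  filter_upwards [eventually_gt_atTop 1] with a ha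
  exact (Sekatskii2014_thm7_holds a ha n hn).symm

/-- **`k_{n,a} → +∞` as `a → −∞`** (`n ≥ 1` fixed) — RH-FREE, by `k_{n,1−a} = k_{n,a}`
(`liSekatskiiSum_one_sub`). [cite: Sekatskii2015FirstApplications, Theorem 5 (large b = −a)] -/
theorem tendsto_liSekatskiiSum_atBot {n : ℕ} (hn : 1 ≤ n) :
    Tendsto (fun a : ℝ ↦ liSekatskiiSum a n) atBot atTop := by
  have h1 : Tendsto (fun a : ℝ ↦ 1 - a) atBot atTop := by
    have := tendsto_atTop_add_const_left atBot (1 : ℝ) tendsto_neg_atBot_atTop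
    exact this.congr fun a ↦ by ring
  refine ((tendsto_liSekatskiiSum_atTop hn).comp h1).congr fun a ↦ ?_
  simp only [Function.comp]
  exact liSekatskiiSum_one_sub a n

/-! ### Theorem 5 -/

/-- Thresholds for the sums: for every `m` there is `c > 1` with `k_{n,a} ≥ 0` for all `a ≥ c` and
all `1 ≤ n ≤ m` (finitely many limits `k_{n,a} → +∞`).
[cite: Sekatskii2015FirstApplications, Theorem 5] -/
theorem exists_forall_liSekatskiiSum_nonneg (m : ℕ) :
    ∃ c : ℝ, 1 < c ∧ ∀ a : ℝ, c ≤ a → ∀ n : ℕ, 1 ≤ n → n ≤ m → 0 ≤ liSekatskiiSum a n := by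
  induction m with
  | zero => exact ⟨2, by norm_num, fun a _ n hn hn0 ↦ by omega⟩
  | succ m ih =>
    obtain ⟨c, hc1, hc⟩ := ih
    obtain ⟨N, hN⟩ := eventually_atTop.1
      ((tendsto_liSekatskiiSum_atTop (Nat.succ_pos m)).eventually_ge_atTop 0)
    refine ⟨max c N, lt_max_of_lt_left hc1, fun a ha n hn hnm ↦ ?_⟩
    rcases Nat.lt_or_ge n (m + 1) with h | h
    · exact hc a ((le_max_left _ _).trans ha) n hn (by omega)
    · have : n = m + 1 := le_antisymm hnm h
      subst this
      exact hN a ((le_max_right _ _).trans ha)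

end Sekatskii2015

/-- **Sekatskii 2015, Theorem 5** (arXiv:1404.7276v2 §3, p. 10; Springer PROMS 358 (2021)): "For any
arbitrary large integer `m` there exists positive real `c` depending on `m` such that the inequality
`(1/(n−1)!) dⁿ/dzⁿ((z+b)^{n−1} ln ξ(z))|_{z=b+1} ≥ 0` does hold true for all `n ≤ m` and all `b ≥ c`."
(`n ≥ 1`, the range of the criterion.)  PROVED, RH-FREE, by Remark 3's road: `k_{n,−b} = (1+2b)·D`
(eq. (6) of [Sekatskii2014], `Sekatskii2014_sum_eq_deriv_holds`), `k_{n,−b} = k_{n,1+b} =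
liSekatskiiArith (1+b) n` (Theorem 7, `Sekatskii2014_thm7_holds`) and `liSekatskiiArith A n → +∞`
(`Sekatskii2015.tendsto_liSekatskiiArith_atTop`).  WHAT THIS IS NOT (§4, p. 16): RH needs `n → ∞` at
FIXED `b`; this is `b → ∞` at bounded `n`. [cite: Sekatskii2015FirstApplications, Theorem 5] -/
theorem sekatskii2015_thm5 (m : ℕ) :
    ∃ c : ℝ, 0 < c ∧ ∀ b : ℝ, c ≤ b → ∀ n : ℕ, 1 ≤ n → n ≤ m →
      0 ≤ liSekatskiiDeriv (-b) (b + 1) n := by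
  obtain ⟨c, hc1, hc⟩ := Sekatskii2015.exists_forall_liSekatskiiSum_nonneg m
  refine ⟨c, by linarith, fun b hb n hn hnm ↦ ?_⟩
  have hb0 : 0 < 1 + 2 * b := by linarith
  have hsum : 0 ≤ liSekatskiiSum (-b) n := by
    rw [← liSekatskiiSum_one_sub (-b) n, show (1 : ℝ) - -b = 1 + b by ring]
    exact hc (1 + b) (by linarith) n hn hnm
  rw [liSekatskiiSum_eq_deriv Sekatskii2014_sum_eq_deriv_holds (-b) hn,
    show (1 : ℝ) - -b = b + 1 by ring, show (1 : ℝ) - 2 * -b = 1 + 2 * b by ring] at hsum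
  exact nonneg_of_mul_nonneg_right hsum hb0

/-- **Theorem 5 for the sums**: for every `m` there is `c` such that `k_{n,a} ≥ 0` for all
`1 ≤ n ≤ m` whenever `|a − ½| ≥ c` (both tails, by `k_{n,1−a} = k_{n,a}`).  RH-FREE.
[cite: Sekatskii2015FirstApplications, Theorem 5] -/
theorem sekatskii2015_thm5_sum (m : ℕ) :
    ∃ c : ℝ, 0 < c ∧ ∀ a : ℝ, c ≤ |a - 1 / 2| → ∀ n : ℕ, 1 ≤ n → n ≤ m →
      0 ≤ liSekatskiiSum a n := by
  obtain ⟨c, hc1, hc⟩ := Sekatskii2015.exists_forall_liSekatskiiSum_nonneg m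
  refine ⟨c, by linarith, fun a ha n hn hnm ↦ ?_⟩
  rcases le_or_gt 0 (a - 1 / 2) with h | h
  · rw [abs_of_nonneg h] at ha
    exact hc a (by linarith) n hn hnm
  · rw [abs_of_neg h] at ha
    rw [← liSekatskiiSum_one_sub a n]
    exact hc (1 - a) (by linarith) n hn hnm

end Literature.NumberTheory.LFunctions
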